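import Literature.MathematicalPhysics.QuantumFieldTheory.Balaban1983to89.Node00.Record13SepLiveSelector
import Literature.MathematicalPhysics.QuantumFieldTheory.Balaban1983to89.Node00.Record13SepBgRowOfClassC1

/-!
# NODE 00 (YM-PLAN Track A) — STAGE 13, REV 18: `Provisos₁₃Sep` AND THE K0⁗ BODY AT THE WITNESS OF THE C¹ ROUTE `θ₁₅ᶜᶜ¹ = theta13OfThm1CC1 F N ε₀ ε₂₉ B₃ B₃' a₀ a₁`
# FROM THE TWO CLASS CLAUSES ([15] Thm 1 (8)–(10)'s regularity half for def-R's background over print's separated sequences) — socket (FILE 12a) ∘ supplier (FILE 13b)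

Cell `pub-ymgap`, seat `pub-ymgap-node00-def-K0a` (g6), FILE 13c.  [15] = [Balaban1985Variational], [6] = [Balaban1985RegularSpaces], [III] = [Balaban1988Convergent].
The FACT-AGNOSTIC re-cut of FILE 12c: there the K0⁗ body was keyed on node00-def-P11's named fact `VariationalThm1ScaledSep` (refuted for every `B₃` by dag-n07-e's
mixed-plaquette obstruction — its EXISTENCE conjunct; the regularity conjunct every consumer reads is untouched) + (h3I)∕(h3MS) + (hcomp); here it is keyed on the two CLASS
CLAUSES that node00-def-P11's FILE 7b `bgRowAt_of_classBoundsC1` actually consumes, displayed at the run objects of `θ₁₅ᶜᶜ¹` — whichever [15]-fact is of record supplies the C⁰ clause on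
the stub side (`plaqSmallOn_UbgMSOfRecord_of_<fact>`), the C¹ clause is [15] Thm 1 (9)–(10)'s gauge-free reading (node00-def-P11 FILE 7a∕7b).
FOR plan's K0⁗ skeleton: two source-keyed stubs `stub_classC0Sep`∕`stub_classC1Sep` (texts = the binders (hclass)∕(hclassC1) of `exists_k0Sep_of_classBounds` below, θ-abstracted)
close `Record13SepInhabited` through ★★★★; `stub_monotoneHistory13` leaves the composition.

WHAT THIS FILE PROVES (theorems only).
* §1 ★★ `provisos₁₃Sep_theta13OfThm1CC1_of_classBounds (hε hε' hB hB' ha₀ ha₁) (hclass) (hclassC1) : θ₁₅ᶜᶜ¹.Provisos₁₃Sep F N` (FILE 12a's `provisos₁₃Sep_theta13LiveOfNumerics_of_bgSep`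
  ∘ FILE 13b's ★★★; the nine core rows are theorems at `θ₁₅ᶜᶜ¹`).
* §2 ★★★★ `exists_k0Sep_of_classBounds (F) (hε hε' hB hB' ha₀ ha₁) (hclass) (hclassC1) : ∃ θ : Stage13Params F 2, θ.Provisos₁₃Sep F 2 ∧ (θ.ZtUnity F 2 ∧ θ.SlotsNondegenerate₁₃ F 2) ∧
  θ.Admissible F 2` — THE REV-18 K0 BODY FOR `F` ⟸ THE TWO CLASS CLAUSES AT `θ₁₅ᶜᶜ¹(F, 2)` — NOTHING ELSE ((C2) is v1.2's run-level antecedent; rows Z ∕ P12 ∕ G ∕ the nine core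
  rows are theorems there).

HONEST FRAMING.  Composition of tree theorems; CONDITIONAL on the two DISPLAYED class clauses (`Prop` hypotheses, NEVER asserted; node00-def-P11 ∕ dag-n07-e lane); nothing of
Bałaban asserted; NOT a discharge; K0⁗ NOT closed by this file (its hypotheses are open stubs); counts unmoved (typed 28∕28 · discharged 5∕28); one finite 𝕋⁴ programme at fixed ε —
NOT continuum ∕ OS ∕ mass gap ∕ Clay.  No `sorry`, `axiom`, `def`, `instance`, `notation`.
-/

noncomputable section

open MeasureTheory
open scoped Matrix.Norms.L2Operator

namespace Literature.MathematicalPhysics.QuantumFieldTheory.Balaban1983to89.Node00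

open T4Continuum B14.Eq218Concrete B15DeterminingSets B12RegularSpaces111 B14RegularSpaces234 B14Radii T4AxialGaugeSmallField

/-! ## §1. `Provisos₁₃Sep` AT `θ₁₅ᶜᶜ¹` from the two class clauses -/

section Witness

variable {F : T4Family} {N : ℕ} [NeZero N] {ε₀ ε₂₉ B₃ B₃' a₀ a₁ : ℝ}

/-- **★★ THE SEPARATED-RANGE PROVISOS OF RECORD AT `θ₁₅ᶜᶜ¹`** from the signs (`0 < ε₀`, `0 < ε₂₉`, `0 ≤ B₃`, `0 ≤ B₃′`, `0 < a₀`, `0 < a₁`) and the two class clauses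
(hclass)∕(hclassC1): FILE 12a's `provisos₁₃Sep_theta13LiveOfNumerics_of_bgSep` ∘ FILE 13b's ★★★ `bgSepAt_theta13OfThm1CC1_of_classBounds` — the nine core rows are theorems at
`θ₁₅ᶜᶜ¹`, row P11 is the supplier's.  CONDITIONAL; nothing of Bałaban asserted. [cite: Balaban1985Variational, Thm 1 (8)–(10) p.279; Balaban1985RegularSpaces, (1.3)–(1.8) p.77; Balaban1988Convergent, (2.10) p.256, (2.18) p.257, (2.27)–(2.28) p.259, (2.34)–(2.41) p.261, (3.16)–(3.22) pp.268–269; Balaban1989LargeFieldI, (0.3)–(0.4) p.176] -/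
theorem provisos₁₃Sep_theta13OfThm1CC1_of_classBounds (hε : 0 < ε₀) (hε' : 0 < ε₂₉) (hB : 0 ≤ B₃) (hB' : 0 ≤ B₃') (ha₀ : 0 < a₀) (ha₁ : 0 < a₁)
    (hclass : ∀ (p : B12.RunParams) (n : ℕ), n ≤ p.K → Step.InInterval (theta13OfThm1CC1 F N ε₀ ε₂₉ B₃ B₃' a₀ a₁).γ n (gOfRecord₁₃ F N (theta13OfThm1CC1 F N ε₀ ε₂₉ B₃ B₃' a₀ a₁) p) → PartCompat₁₃ F N (theta13OfThm1CC1 F N ε₀ ε₂₉ B₃ B₃' a₀ a₁) p n →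
      ∀ s : SeqOfRecord F (theta13OfThm1CC1 F N ε₀ ε₂₉ B₃ B₃' a₀ a₁).ν (theta13OfThm1CC1 F N ε₀ ε₂₉ B₃ B₃' a₀ a₁).τ9.M (gOfRecord₁₃ F N (theta13OfThm1CC1 F N ε₀ ε₂₉ B₃ B₃' a₀ a₁) p) p.K n, Sect2.SeqSeparated (theta13OfThm1CC1 F N ε₀ ε₂₉ B₃ B₃' a₀ a₁).ν.M₁ s → ∀ W : MSField (F.P p.K) (SU N),
      W ∈ suppOfRecord₁₃ F N (theta13OfThm1CC1 F N ε₀ ε₂₉ B₃ B₃' a₀ a₁) p n s → W ∈ solvableDom (avOfRecord F N p.K) (regMSOfRecord F N (theta13OfThm1CC1 F N ε₀ ε₂₉ B₃ B₃' a₀ a₁).ν p.K n s.Ω) (genSet s.Ω n) →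
      ∀ m, m ≤ n → PlaqSmallOn (omegaPlaqs s.Ω m) (B₃ * ((theta13OfThm1CC1 F N ε₀ ε₂₉ B₃ B₃' a₀ a₁).s2.cR * epsOfRecord (theta13OfThm1CC1 F N ε₀ ε₂₉ B₃ B₃' a₀ a₁).ν (gOfRecord₁₃ F N (theta13OfThm1CC1 F N ε₀ ε₂₉ B₃ B₃' a₀ a₁) p) m) * (F.P p.K).eta m ^ 2)
        (UbgMSOfRecord F N (theta13OfThm1CC1 F N ε₀ ε₂₉ B₃ B₃' a₀ a₁).ν (theta13OfThm1CC1 F N ε₀ ε₂₉ B₃ B₃' a₀ a₁).τ9.M (gOfRecord₁₃ F N (theta13OfThm1CC1 F N ε₀ ε₂₉ B₃ B₃' a₀ a₁) p) p.K n s W))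
    (hclassC1 : ∀ (p : B12.RunParams) (n : ℕ), n ≤ p.K → Step.InInterval (theta13OfThm1CC1 F N ε₀ ε₂₉ B₃ B₃' a₀ a₁).γ n (gOfRecord₁₃ F N (theta13OfThm1CC1 F N ε₀ ε₂₉ B₃ B₃' a₀ a₁) p) → PartCompat₁₃ F N (theta13OfThm1CC1 F N ε₀ ε₂₉ B₃ B₃' a₀ a₁) p n →
      ∀ s : SeqOfRecord F (theta13OfThm1CC1 F N ε₀ ε₂₉ B₃ B₃' a₀ a₁).ν (theta13OfThm1CC1 F N ε₀ ε₂₉ B₃ B₃' a₀ a₁).τ9.M (gOfRecord₁₃ F N (theta13OfThm1CC1 F N ε₀ ε₂₉ B₃ B₃' a₀ a₁) p) p.K n, Sect2.SeqSeparated (theta13OfThm1CC1 F N ε₀ ε₂₉ B₃ B₃' a₀ a₁).ν.M₁ s → ∀ W : MSField (F.P p.K) (SU N),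
      W ∈ suppOfRecord₁₃ F N (theta13OfThm1CC1 F N ε₀ ε₂₉ B₃ B₃' a₀ a₁) p n s → W ∈ solvableDom (avOfRecord F N p.K) (regMSOfRecord F N (theta13OfThm1CC1 F N ε₀ ε₂₉ B₃ B₃' a₀ a₁).ν p.K n s.Ω) (genSet s.Ω n) →
      ∀ m, 1 ≤ m → m ≤ n → PlaqC1SmallOn (plaqInside (s.Ω m)) (B₃' * ((theta13OfThm1CC1 F N ε₀ ε₂₉ B₃ B₃' a₀ a₁).s2.cR * epsOfRecord (theta13OfThm1CC1 F N ε₀ ε₂₉ B₃ B₃' a₀ a₁).ν (gOfRecord₁₃ F N (theta13OfThm1CC1 F N ε₀ ε₂₉ B₃ B₃' a₀ a₁) p) m) * (F.P p.K).eta m ^ 3)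
        (UbgMSOfRecord F N (theta13OfThm1CC1 F N ε₀ ε₂₉ B₃ B₃' a₀ a₁).ν (theta13OfThm1CC1 F N ε₀ ε₂₉ B₃ B₃' a₀ a₁).τ9.M (gOfRecord₁₃ F N (theta13OfThm1CC1 F N ε₀ ε₂₉ B₃ B₃' a₀ a₁) p) p.K n s W)) :
    (theta13OfThm1CC1 F N ε₀ ε₂₉ B₃ B₃' a₀ a₁).Provisos₁₃Sep F N :=
  provisos₁₃Sep_theta13LiveOfNumerics_of_bgSep F N (stage12NumericsOfThm1CC1 F.L ε₀ B₃ B₃' a₀ a₁) ε₂₉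
    (bgSepAt_theta13OfThm1CC1_of_classBounds hε hε' hB hB' ha₀ ha₁ hclass hclassC1)

end Witness

/-! ## §2. ★★★★ THE REV-18 K0 BODY FOR `F` AT `N = 2` FROM THE TWO CLASS CLAUSES — socket ∘ supplier -/

section Closure

variable {ε₀ ε₂₉ B₃ B₃' a₀ a₁ : ℝ}

/-- **★★★★ THE REV-18 K0 BODY FOR `F` (`∃ θ, θ.Provisos₁₃Sep F 2 ∧ (ZtUnity ∧ SlotsNondegenerate₁₃) ∧ Admissible`) FROM THE TWO CLASS CLAUSES OF [15] THEOREM 1 FOR PRINT'S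
SEQUENCES AT THE WITNESS OF THE C¹ ROUTE** — under the signs `0 < ε₀`, `0 < ε₂₉`, `0 ≤ B₃`, `0 ≤ B₃′`, `0 < a₀`, `0 < a₁`: (hclass) the C⁰ clause «for every windowed,
partition-compatible run, every SEPARATED sequence `s`, every regular retained datum `𝐖 ∈ suppOfRecord₁₃` admitting a minimiser in print's class, def-R's background
`UbgMSOfRecord … s 𝐖` has `|U(∂p) − 1| < B₃·cR·ε_m·η_m²` on the plaquettes of `Ω_m`, `m ≤ n`» ((8); node00-def-P11's `plaqSmallOn_UbgMSOfRecord_of_…` currency) and (hclassC1)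
the C¹ clause «… covariant adjacent-plaquette differences `< B₃′·cR·ε_m·η_m³` inside `Ω_m`, `1 ≤ m ≤ n`» ((9)–(10), gauge-free reading) — at `θ₁₅ᶜᶜ¹(F, 2)`; (C2) is v1.2's
run-level antecedent (consumed pointwise); rows Z ∕ P12 ∕ G and the nine core rows are theorems there.  NO named fact, NO (hcomp)∕(hmono), NO (h3I)∕(h3MS).  CONDITIONAL —
nothing of Bałaban asserted; K0⁗ NOT closed here. [cite: Balaban1985Variational, Thm 1 (8)–(10) p.279; Balaban1985RegularSpaces, (1.3)–(1.8) p.77; Balaban1988Convergent, Thm 1 p.262, (2.10) p.256, (2.27)–(2.28) p.259, (2.34)–(2.41) p.261, p.257, (3.16)–(3.22) pp.268–269; Balaban1989LargeFieldI, (0.3)–(0.4) p.176] -/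
theorem exists_k0Sep_of_classBounds (F : T4Family) (hε : 0 < ε₀) (hε' : 0 < ε₂₉) (hB : 0 ≤ B₃) (hB' : 0 ≤ B₃') (ha₀ : 0 < a₀) (ha₁ : 0 < a₁)
    (hclass : ∀ (p : B12.RunParams) (n : ℕ), n ≤ p.K → Step.InInterval (theta13OfThm1CC1 F 2 ε₀ ε₂₉ B₃ B₃' a₀ a₁).γ n (gOfRecord₁₃ F 2 (theta13OfThm1CC1 F 2 ε₀ ε₂₉ B₃ B₃' a₀ a₁) p) → PartCompat₁₃ F 2 (theta13OfThm1CC1 F 2 ε₀ ε₂₉ B₃ B₃' a₀ a₁) p n →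
      ∀ s : SeqOfRecord F (theta13OfThm1CC1 F 2 ε₀ ε₂₉ B₃ B₃' a₀ a₁).ν (theta13OfThm1CC1 F 2 ε₀ ε₂₉ B₃ B₃' a₀ a₁).τ9.M (gOfRecord₁₃ F 2 (theta13OfThm1CC1 F 2 ε₀ ε₂₉ B₃ B₃' a₀ a₁) p) p.K n, Sect2.SeqSeparated (theta13OfThm1CC1 F 2 ε₀ ε₂₉ B₃ B₃' a₀ a₁).ν.M₁ s → ∀ W : MSField (F.P p.K) (SU 2),
      W ∈ suppOfRecord₁₃ F 2 (theta13OfThm1CC1 F 2 ε₀ ε₂₉ B₃ B₃' a₀ a₁) p n s → W ∈ solvableDom (avOfRecord F 2 p.K) (regMSOfRecord F 2 (theta13OfThm1CC1 F 2 ε₀ ε₂₉ B₃ B₃' a₀ a₁).ν p.K n s.Ω) (genSet s.Ω n) →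
      ∀ m, m ≤ n → PlaqSmallOn (omegaPlaqs s.Ω m) (B₃ * ((theta13OfThm1CC1 F 2 ε₀ ε₂₉ B₃ B₃' a₀ a₁).s2.cR * epsOfRecord (theta13OfThm1CC1 F 2 ε₀ ε₂₉ B₃ B₃' a₀ a₁).ν (gOfRecord₁₃ F 2 (theta13OfThm1CC1 F 2 ε₀ ε₂₉ B₃ B₃' a₀ a₁) p) m) * (F.P p.K).eta m ^ 2)
        (UbgMSOfRecord F 2 (theta13OfThm1CC1 F 2 ε₀ ε₂₉ B₃ B₃' a₀ a₁).ν (theta13OfThm1CC1 F 2 ε₀ ε₂₉ B₃ B₃' a₀ a₁).τ9.M (gOfRecord₁₃ F 2 (theta13OfThm1CC1 F 2 ε₀ ε₂₉ B₃ B₃' a₀ a₁) p) p.K n s W))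
    (hclassC1 : ∀ (p : B12.RunParams) (n : ℕ), n ≤ p.K → Step.InInterval (theta13OfThm1CC1 F 2 ε₀ ε₂₉ B₃ B₃' a₀ a₁).γ n (gOfRecord₁₃ F 2 (theta13OfThm1CC1 F 2 ε₀ ε₂₉ B₃ B₃' a₀ a₁) p) → PartCompat₁₃ F 2 (theta13OfThm1CC1 F 2 ε₀ ε₂₉ B₃ B₃' a₀ a₁) p n →
      ∀ s : SeqOfRecord F (theta13OfThm1CC1 F 2 ε₀ ε₂₉ B₃ B₃' a₀ a₁).ν (theta13OfThm1CC1 F 2 ε₀ ε₂₉ B₃ B₃' a₀ a₁).τ9.M (gOfRecord₁₃ F 2 (theta13OfThm1CC1 F 2 ε₀ ε₂₉ B₃ B₃' a₀ a₁) p) p.K n, Sect2.SeqSeparated (theta13OfThm1CC1 F 2 ε₀ ε₂₉ B₃ B₃' a₀ a₁).ν.M₁ s → ∀ W : MSField (F.P p.K) (SU 2),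
      W ∈ suppOfRecord₁₃ F 2 (theta13OfThm1CC1 F 2 ε₀ ε₂₉ B₃ B₃' a₀ a₁) p n s → W ∈ solvableDom (avOfRecord F 2 p.K) (regMSOfRecord F 2 (theta13OfThm1CC1 F 2 ε₀ ε₂₉ B₃ B₃' a₀ a₁).ν p.K n s.Ω) (genSet s.Ω n) →
      ∀ m, 1 ≤ m → m ≤ n → PlaqC1SmallOn (plaqInside (s.Ω m)) (B₃' * ((theta13OfThm1CC1 F 2 ε₀ ε₂₉ B₃ B₃' a₀ a₁).s2.cR * epsOfRecord (theta13OfThm1CC1 F 2 ε₀ ε₂₉ B₃ B₃' a₀ a₁).ν (gOfRecord₁₃ F 2 (theta13OfThm1CC1 F 2 ε₀ ε₂₉ B₃ B₃' a₀ a₁) p) m) * (F.P p.K).eta m ^ 3)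
        (UbgMSOfRecord F 2 (theta13OfThm1CC1 F 2 ε₀ ε₂₉ B₃ B₃' a₀ a₁).ν (theta13OfThm1CC1 F 2 ε₀ ε₂₉ B₃ B₃' a₀ a₁).τ9.M (gOfRecord₁₃ F 2 (theta13OfThm1CC1 F 2 ε₀ ε₂₉ B₃ B₃' a₀ a₁) p) p.K n s W)) :
    ∃ θ : Stage13Params F 2, θ.Provisos₁₃Sep F 2 ∧ (θ.ZtUnity F 2 ∧ θ.SlotsNondegenerate₁₃ F 2) ∧ θ.Admissible F 2 :=
  ⟨(theta13OfThm1CC1 F 2 ε₀ ε₂₉ B₃ B₃' a₀ a₁), provisos₁₃Sep_theta13OfThm1CC1_of_classBounds hε hε' hB hB' ha₀ ha₁ hclass hclassC1,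
    ⟨ztUnity_theta13OfThm1CC1 F 2 ε₀ ε₂₉ B₃ B₃' a₀ a₁, slotsNondegenerate₁₃_theta13OfThm1CC1 F 2 ε₀ ε₂₉ B₃ B₃' a₀ a₁⟩,
    admissible_theta13OfThm1CC1 F 2 hε hε' hB hB' ha₀ ha₁⟩

end Closure

end Literature.MathematicalPhysics.QuantumFieldTheory.Balaban1983to89.Node00

end
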